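import Summits.QuantumFields.YangMills.Theorems.ChatterjeeMassGapTorusAxialBoxBitCompact
import HarnessLib

/-!
# S28ᵀ (Chatterjee torus-axial mass gap) — the box cumulant as a spectral moment:
`κ_□ ≥ ‖φ⋆φ‖⁸ / ‖φ‖⁶` (ym-idea-4 g7, LINE-20, card «spectral / trace methods»)

LINE-18 (`S28BoxConvGluing.box_integral_eq_conv`, `S28BoxBitCompact.boxCumulant_pos`) identified
the box cumulant of the S28ᵀ island fork with the tenth convolution power of the centred
character `φ = Re tr ρ − ∫ Re tr ρ` at the identity, `κ_□ = φ^{⋆10}(1) = ‖φ^{⋆5}‖² > 0`. This file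
reads the convolution powers SPECTRALLY, with nothing but Cauchy–Schwarz: the numbers
`M(k) = φ^{⋆(k+2)}(1)` are the moments `⟨T_φ^k φ, φ⟩_{L²(G)}` of the (symmetric) one-plaquette
convolution operator `T_φ f = f ⋆ φ`, so the even moments `M(2j) = ‖φ^{⋆(j+1)}‖²` form a
LOG-CONVEX sequence — and the order-8 datum of the strong-coupling expansion is bounded below by
the order-2 and order-4 data:

* `conv_power_gram` — `⟨P a, P b⟩_{L²} = P (a+b+1)(1)` (Gram structure of the powers
  `P k = φ^{⋆(k+1)}`);
* `integral_mul_sq_le` — Cauchy–Schwarz for continuous functions on the compact group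
  (discriminant form);
* `conv_power_logconvex` — `P(2a+3)(1)² ≤ P(2a+1)(1) · P(2a+5)(1)`;
* **`conv_power_nine_ge`** — `φ^{⋆4}(1)⁴ ≤ φ^{⋆2}(1)³ · φ^{⋆10}(1)`, i.e.
  `κ = ‖φ^{⋆5}‖² ≥ ‖φ⋆φ‖⁸ / ‖φ‖⁶`, with equality when `φ` is an eigenfunction of `T_φ` (every
  irreducible `ρ`: `U(1)` `2⁻⁹`, `SU(2)` `2⁻⁸`, `SU(N≥3)` `2⁻⁹N⁻⁸`, `SU(3)` adjoint `8⁻⁸` are all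
  equalities) and strict otherwise (`SU(2)`, spin `½ ⊕ 1`: `κ = 4⁻⁴ + 9⁻⁴ > (13/36)⁴/2`);
* **`box_integral_ge`**, **`boxCumulant_ge`** — the lattice form: for every compact `G` and every
  continuous `ρ` with `Re tr ρ(h⁻¹) = Re tr ρ(h)`,
  `κ_□(G,ρ) · (∫ φ²)³ ≥ (∫ (φ⋆φ)²)⁴` where `∫ φ² = Var_Haar(Re tr ρ)` is the one-plaquette variance
  (the `β²` datum) and `∫ (φ⋆φ)² = φ^{⋆4}(1)` the four-face tube integral (the `β⁴` datum) —
  an explicit, instrument-checkable lower bound for the eighth strong-coupling coefficient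
  `8!·κ_□` of the one bit in terms of two low-order Haar integrals.

Bears on rung S28ᵀ (record lane, item 8941) through the fork
`S28BoxBit.gapCore_eventually_of_boxCumulant`: a quantitative form of its obligation (O2).
No summit is proved here (island/small-β input only; the Yang–Mills mass gap is NOT proved).
-/

noncomputable section

open MeasureTheory Filter Topology
open Literature.MathematicalPhysics.QuantumLattice
open Literature.MathematicalPhysics.QuantumFieldTheory (zdHaar haarProbability)
open Literature.Probability.LatticeModels (Site)

namespace Summit.QuantumFields.YangMills.Theorems.S28BoxConvMoments

open S28BoxConv S28BoxConvGluing

variable {G : Type} [Group G] [TopologicalSpace G] [IsTopologicalGroup G]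
  [CompactSpace G] [MeasurableSpace G] [BorelSpace G] [SecondCountableTopology G] [T2Space G]

omit [SecondCountableTopology G] in
/-- **Gram structure of the convolution powers**: `⟨P a, P b⟩_{L²(G)} = P (a+b+1)(1)`. [folklore] -/
theorem conv_power_gram {φ : G → ℝ} {P : ℕ → G → ℝ} (hφ : Continuous φ)
    (hcl : ∀ s t : G, φ (s * t) = φ (t * s)) (hinv : ∀ h : G, φ h⁻¹ = φ h) (hP0 : P 0 = φ)
    (hstep : ∀ k : ℕ, P (k + 1) = haarConv (P k) φ) (a b : ℕ) :
    ∫ h, P a h * P b h ∂haarProbability G = P (a + b + 1) 1 := by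
  rw [← conv_power_add hφ hP0 hstep (conv_power_continuous hφ hP0 hstep) a b,
    haarConv_apply_one_of_symm (conv_power_inv hcl hinv hP0 hstep a)]
  refine integral_congr_ae (Eventually.of_forall fun h => ?_)
  beta_reduce
  rw [mul_comm]

omit [SecondCountableTopology G] [T2Space G] in
/-- **Cauchy–Schwarz** for continuous real functions on the compact group:
`(∫ f g)² ≤ (∫ f²)(∫ g²)` (discriminant of `t ↦ ∫ (t g − f)² ≥ 0`). [folklore] -/
theorem integral_mul_sq_le {f g : G → ℝ} (hf : Continuous f) (hg : Continuous g) :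
    (∫ h, f h * g h ∂haarProbability G) ^ 2 ≤
      (∫ h, f h ^ 2 ∂haarProbability G) * ∫ h, g h ^ 2 ∂haarProbability G := by
  have hi : ∀ {u : G → ℝ}, Continuous u → Integrable u (haarProbability G) := fun hu =>
    hu.integrable_of_hasCompactSupport (HasCompactSupport.of_compactSpace _)
  have hq : ∀ t : ℝ, 0 ≤ (∫ h, g h ^ 2 ∂haarProbability G) * (t * t) +
      (-2 * ∫ h, f h * g h ∂haarProbability G) * t + ∫ h, f h ^ 2 ∂haarProbability G := by
    intro t
    have h0 : 0 ≤ ∫ h, (t * g h - f h) ^ 2 ∂haarProbability G :=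
      integral_nonneg fun h => sq_nonneg _
    have he : ∫ h, (t * g h - f h) ^ 2 ∂haarProbability G =
        (∫ h, g h ^ 2 ∂haarProbability G) * (t * t) +
          (-2 * ∫ h, f h * g h ∂haarProbability G) * t + ∫ h, f h ^ 2 ∂haarProbability G := by
      have e1 : ∀ h, (t * g h - f h) ^ 2 = t * t * g h ^ 2 - 2 * t * (f h * g h) + f h ^ 2 :=
        fun h => by ring
      simp_rw [e1]
      have iA : Integrable (fun h => t * t * g h ^ 2 - 2 * t * (f h * g h)) (haarProbability G) :=
        hi (by fun_prop)
      have iC : Integrable (fun h => f h ^ 2) (haarProbability G) := hi (by fun_prop)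
      have iA1 : Integrable (fun h => t * t * g h ^ 2) (haarProbability G) := hi (by fun_prop)
      have iA2 : Integrable (fun h => 2 * t * (f h * g h)) (haarProbability G) := hi (by fun_prop)
      rw [integral_add iA iC, integral_sub iA1 iA2, integral_const_mul, integral_const_mul]
      ring
    rw [← he]
    exact h0
  have hd := discrim_le_zero hq
  rw [discrim] at hd
  nlinarith [hd]

omit [SecondCountableTopology G] in
/-- **Log-convexity of the even moments**: `P(2a+3)(1)² ≤ P(2a+1)(1) · P(2a+5)(1)`
(`P(2a+3)(1) = ⟨P a, P (a+2)⟩`, Cauchy–Schwarz, `‖P a‖² = P(2a+1)(1)`,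
`‖P(a+2)‖² = P(2a+5)(1)`). [folklore] -/
theorem conv_power_logconvex {φ : G → ℝ} {P : ℕ → G → ℝ} (hφ : Continuous φ)
    (hcl : ∀ s t : G, φ (s * t) = φ (t * s)) (hinv : ∀ h : G, φ h⁻¹ = φ h) (hP0 : P 0 = φ)
    (hstep : ∀ k : ℕ, P (k + 1) = haarConv (P k) φ) (a : ℕ) :
    P (2 * a + 3) 1 ^ 2 ≤ P (2 * a + 1) 1 * P (2 * a + 5) 1 := by
  have hPc := conv_power_continuous hφ hP0 hstep
  have h1 := conv_power_gram hφ hcl hinv hP0 hstep a (a + 2)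
  have h2 := conv_power_gram hφ hcl hinv hP0 hstep a a
  have h3 := conv_power_gram hφ hcl hinv hP0 hstep (a + 2) (a + 2)
  rw [show a + (a + 2) + 1 = 2 * a + 3 by ring] at h1
  rw [show a + a + 1 = 2 * a + 1 by ring] at h2
  rw [show a + 2 + (a + 2) + 1 = 2 * a + 5 by ring] at h3
  rw [← h1, ← h2, ← h3]
  have e2 : ∫ h, P a h * P a h ∂haarProbability G = ∫ h, P a h ^ 2 ∂haarProbability G :=
    integral_congr_ae (Eventually.of_forall fun h => by beta_reduce; rw [sq])
  have e3 : ∫ h, P (a + 2) h * P (a + 2) h ∂haarProbability G =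
      ∫ h, P (a + 2) h ^ 2 ∂haarProbability G :=
    integral_congr_ae (Eventually.of_forall fun h => by beta_reduce; rw [sq])
  rw [e2, e3]
  exact integral_mul_sq_le (hPc a) (hPc (a + 2))

omit [SecondCountableTopology G] in
/-- **The tenth convolution power dominates: `φ^{⋆4}(1)⁴ ≤ φ^{⋆2}(1)³ · φ^{⋆10}(1)`**, i.e.
`κ = ‖φ^{⋆5}‖² ≥ ‖φ ⋆ φ‖⁸ / ‖φ‖⁶` — from three log-convexity inequalities
(`e₁² ≤ e₀e₂`, `e₂² ≤ e₁e₃`, `e₃² ≤ e₂e₄` for `e_j = P(2j+1)(1) > 0`). [folklore] -/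
theorem conv_power_nine_ge {φ : G → ℝ} {P : ℕ → G → ℝ} (hφ : Continuous φ)
    (hcl : ∀ s t : G, φ (s * t) = φ (t * s)) (hinv : ∀ h : G, φ h⁻¹ = φ h) (hP0 : P 0 = φ)
    (hstep : ∀ k : ℕ, P (k + 1) = haarConv (P k) φ) :
    P 3 1 ^ 4 ≤ P 1 1 ^ 3 * P 9 1 := by
  by_cases h0 : ∃ g, φ g ≠ 0
  · have i0 := conv_power_logconvex hφ hcl hinv hP0 hstep 0
    have i1 := conv_power_logconvex hφ hcl hinv hP0 hstep 1
    have i2 := conv_power_logconvex hφ hcl hinv hP0 hstep 2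
    norm_num at i0 i1 i2
    -- positivity of the even moments
    have h0' : ∃ g, P 0 g ≠ 0 := by rw [hP0]; exact h0
    have p1 : 0 < P 1 1 := conv_power_double_pos hφ hcl hinv hP0 hstep (a := 0) h0'
    have p3 : 0 < P 3 1 := conv_power_double_pos hφ hcl hinv hP0 hstep (a := 1) ⟨1, p1.ne'⟩
    have p5 : 0 < P 5 1 := conv_power_double_pos hφ hcl hinv hP0 hstep (a := 2)
      (conv_power_ne_of_succ hstep (k := 2) ⟨1, p3.ne'⟩)
    -- e₂³ ≤ e₁² e₄ from i1, i2
    have j1 : P 5 1 ^ 3 ≤ P 3 1 ^ 2 * P 9 1 := by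
      have : P 5 1 ^ 4 ≤ P 3 1 ^ 2 * (P 5 1 * P 9 1) := by
        calc P 5 1 ^ 4 = (P 5 1 ^ 2) ^ 2 := by ring
          _ ≤ (P 3 1 * P 7 1) ^ 2 := by gcongr
          _ = P 3 1 ^ 2 * P 7 1 ^ 2 := by ring
          _ ≤ P 3 1 ^ 2 * (P 5 1 * P 9 1) := by gcongr
      have h5 : P 5 1 ^ 4 = P 5 1 ^ 3 * P 5 1 := by ring
      rw [h5, show P 3 1 ^ 2 * (P 5 1 * P 9 1) = P 3 1 ^ 2 * P 9 1 * P 5 1 by ring] at this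
      exact le_of_mul_le_mul_right this p5
    -- e₁⁶ ≤ e₀³ e₂³ ≤ e₀³ e₁² e₄
    have j2 : P 3 1 ^ 6 ≤ P 1 1 ^ 3 * (P 3 1 ^ 2 * P 9 1) := by
      calc P 3 1 ^ 6 = (P 3 1 ^ 2) ^ 3 := by ring
        _ ≤ (P 1 1 * P 5 1) ^ 3 := by gcongr
        _ = P 1 1 ^ 3 * P 5 1 ^ 3 := by ring
        _ ≤ P 1 1 ^ 3 * (P 3 1 ^ 2 * P 9 1) := by gcongr
    have h6 : P 3 1 ^ 6 = P 3 1 ^ 4 * P 3 1 ^ 2 := by ring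
    rw [h6, show P 1 1 ^ 3 * (P 3 1 ^ 2 * P 9 1) = P 1 1 ^ 3 * P 9 1 * P 3 1 ^ 2 by ring] at j2
    exact le_of_mul_le_mul_right j2 (by positivity)
  · -- `φ ≡ 0`: every power vanishes
    simp only [not_exists, not_not] at h0
    have hz : ∀ k z, P (k + 1) z = 0 := fun k z => by
      simp [hstep, haarConv_apply, h0]
    rw [hz 2, hz 0, hz 8]
    norm_num

/-- **Lattice form, class-function version.** For a continuous inversion-invariant class function
`φ`: `(∫ (φ⋆φ)²)⁴ ≤ (∫ φ²)³ · ∫ ∏_{f ∈ ∂B} φ(U_f) dg_∞` — the box integral (`= φ^{⋆10}(1)`,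
`S28BoxConvGluing.box_integral_eq_conv`) dominates `‖φ⋆φ‖⁸/‖φ‖⁶`. [folklore] -/
theorem box_integral_ge {φ : G → ℝ} (hφ : Continuous φ) (hcl : ∀ s t : G, φ (s * t) = φ (t * s))
    (hinv : ∀ h : G, φ h⁻¹ = φ h) :
    (∫ h, haarConv φ φ h ^ 2 ∂haarProbability G) ^ 4 ≤
      (∫ h, φ h ^ 2 ∂haarProbability G) ^ 3 *
    ∫ U,
      φ (U (![0, 0, 0, 0], 1) * U (![0, 1, 0, 0], 2) * (U (![0, 0, 1, 0], 1))⁻¹ *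
      (U (![0, 0, 0, 0], 2))⁻¹) * φ (U (![2, 0, 0, 0], 1) * U (![2, 1, 0, 0], 2) *
      (U (![2, 0, 1, 0], 1))⁻¹ * (U (![2, 0, 0, 0], 2))⁻¹) * φ (U (![0, 0, 0, 0], 0) *
      U (![1, 0, 0, 0], 1) * (U (![0, 1, 0, 0], 0))⁻¹ * (U (![0, 0, 0, 0], 1))⁻¹) *
      φ (U (![0, 0, 1, 0], 0) * U (![1, 0, 1, 0], 1) * (U (![0, 1, 1, 0], 0))⁻¹ *
      (U (![0, 0, 1, 0], 1))⁻¹) * φ (U (![0, 0, 0, 0], 0) * U (![1, 0, 0, 0], 2) *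
      (U (![0, 0, 1, 0], 0))⁻¹ * (U (![0, 0, 0, 0], 2))⁻¹) * φ (U (![0, 1, 0, 0], 0) *
      U (![1, 1, 0, 0], 2) * (U (![0, 1, 1, 0], 0))⁻¹ * (U (![0, 1, 0, 0], 2))⁻¹) *
      φ (U (![1, 0, 0, 0], 0) * U (![2, 0, 0, 0], 1) * (U (![1, 1, 0, 0], 0))⁻¹ *
      (U (![1, 0, 0, 0], 1))⁻¹) * φ (U (![1, 0, 1, 0], 0) * U (![2, 0, 1, 0], 1) *
      (U (![1, 1, 1, 0], 0))⁻¹ * (U (![1, 0, 1, 0], 1))⁻¹) * φ (U (![1, 0, 0, 0], 0) *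
      U (![2, 0, 0, 0], 2) * (U (![1, 0, 1, 0], 0))⁻¹ * (U (![1, 0, 0, 0], 2))⁻¹) *
      φ (U (![1, 1, 0, 0], 0) * U (![2, 1, 0, 0], 2) * (U (![1, 1, 1, 0], 0))⁻¹ *
      (U (![1, 1, 0, 0], 2))⁻¹) ∂zdHaar 4 G := by
  obtain ⟨P, hP0, hstep⟩ :
      ∃ P : ℕ → G → ℝ, P 0 = φ ∧ ∀ k : ℕ, P (k + 1) = haarConv (P k) φ :=
    ⟨fun k => Nat.rec φ (fun _ ψ => haarConv ψ φ) k, rfl, fun _ => rfl⟩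
  have hPc := conv_power_continuous hφ hP0 hstep
  have hPcl := conv_power_class hcl hP0 hstep
  have hkerX : ∀ (k : ℕ) (x y : G),
      ∫ g, P k (x * g⁻¹) * φ (g * y) ∂haarProbability G = P (k + 1) (x * y) :=
    fun k x y => by rw [kernel_right, hstep k]
  have hkerW : ∀ (k : ℕ) (x y : G),
      ∫ g, φ (x * g⁻¹) * P k (g * y) ∂haarProbability G = P (k + 1) (x * y) :=
    fun k x y => by rw [kernel_left _ _ (hPcl k), hstep k]
  rw [box_integral_eq_conv hP0 hPc hPcl hinv hkerX hkerW]
  have e1 : ∫ h, φ h ^ 2 ∂haarProbability G = P 1 1 := by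
    rw [conv_power_double_at_one hφ hcl hinv hP0 hstep 0, hP0]
  have e3 : ∫ h, haarConv φ φ h ^ 2 ∂haarProbability G = P 3 1 := by
    rw [conv_power_double_at_one hφ hcl hinv hP0 hstep 1, hstep 0, hP0]
  rw [e1, e3]
  exact conv_power_nine_ge hφ hcl hinv hP0 hstep

variable {N : ℕ} (ρ : G →* Matrix (Fin N) (Fin N) ℂ)

/-- **Lattice form for the gauge theory: an explicit lower bound for the box cumulant of the S28ᵀ
island fork.** For every compact metrisable `G` and every continuous `ρ : G →* M_N(ℂ)` with
`Re tr ρ(h⁻¹) = Re tr ρ(h)`, with `φ = Re tr ρ − ∫ Re tr ρ`: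
`(∫ (φ⋆φ)²)⁴ ≤ (Var_Haar Re tr ρ)³ · κ_□(G, ρ)` — the eighth strong-coupling coefficient `8!·κ_□`
of the one bit is bounded below by the one-plaquette variance (order `β²`) and the four-face
tube integral `φ^{⋆4}(1) = ∫ (φ⋆φ)²` (order `β⁴`); equality for every irreducible `ρ`.
No summit is proved. [folklore] -/
theorem boxCumulant_ge (hρc : Continuous ρ)
    (hinv : ∀ h : G, ((ρ h⁻¹).trace).re = ((ρ h).trace).re) :
    (∫ h, haarConv (fun g => ((ρ g).trace).re - ∫ g, (ρ g).trace.re ∂(haarProbability G))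
        (fun g => ((ρ g).trace).re - ∫ g, (ρ g).trace.re ∂(haarProbability G)) h ^ 2
        ∂haarProbability G) ^ 4 ≤
      (∫ h, (((ρ h).trace).re - ∫ g, (ρ g).trace.re ∂(haarProbability G)) ^ 2
        ∂haarProbability G) ^ 3 *
      (∫ U,
          (plaquetteObs ρ (0 : Site 4) 1 2 U - ∫ g, (ρ g).trace.re ∂(haarProbability G)) *
          (plaquetteObs ρ (Pi.single 0 2 : Site 4) 1 2 U
              - ∫ g, (ρ g).trace.re ∂(haarProbability G)) *
          (plaquetteObs ρ (0 : Site 4) 0 1 U - ∫ g, (ρ g).trace.re ∂(haarProbability G)) *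
          (plaquetteObs ρ (Pi.single 2 1 : Site 4) 0 1 U
              - ∫ g, (ρ g).trace.re ∂(haarProbability G)) *
          (plaquetteObs ρ (0 : Site 4) 0 2 U - ∫ g, (ρ g).trace.re ∂(haarProbability G)) *
          (plaquetteObs ρ (Pi.single 1 1 : Site 4) 0 2 U
              - ∫ g, (ρ g).trace.re ∂(haarProbability G)) *
          (plaquetteObs ρ (Pi.single 0 1 : Site 4) 0 1 U
              - ∫ g, (ρ g).trace.re ∂(haarProbability G)) *
          (plaquetteObs ρ (Pi.single 0 1 + Pi.single 2 1 : Site 4) 0 1 U -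
              ∫ g, (ρ g).trace.re ∂(haarProbability G)) *
          (plaquetteObs ρ (Pi.single 0 1 : Site 4) 0 2 U
              - ∫ g, (ρ g).trace.re ∂(haarProbability G)) *
          (plaquetteObs ρ (Pi.single 0 1 + Pi.single 1 1 : Site 4) 0 2 U -
              ∫ g, (ρ g).trace.re ∂(haarProbability G)) ∂(zdHaar 4 G)) := by
  have key := box_integral_ge (G := G)
    (φ := fun h => ((ρ h).trace).re - ∫ g, (ρ g).trace.re ∂(haarProbability G))
    ((Complex.continuous_re.comp hρc.matrix_trace).sub continuous_const)
    (fun s t => by rw [S28BoxBitSUN.re_trace_map_mul_comm ρ s t]) (fun h => by rw [hinv h])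
  refine le_of_le_of_eq key ?_
  congr 1
  refine integral_congr_ae (Eventually.of_forall fun U => ?_)
  have s0 : (0 : Site 4) = ![0, 0, 0, 0] := by decide +kernel
  have s1 : (Pi.single 0 2 : Site 4) = ![2, 0, 0, 0] := by decide +kernel
  have s2 : (Pi.single 2 1 : Site 4) = ![0, 0, 1, 0] := by decide +kernel
  have s3 : (Pi.single 1 1 : Site 4) = ![0, 1, 0, 0] := by decide +kernel
  have s4 : (Pi.single 0 1 : Site 4) = ![1, 0, 0, 0] := by decide +kernel
  simp only [plaquetteObs, plaquetteHolonomyZd, s0, s1, s2, s3, s4, Matrix.cons_add_cons,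
    Matrix.empty_add_empty, Int.reduceAdd]

end Summit.QuantumFields.YangMills.Theorems.S28BoxConvMoments
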